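import Literature.MathematicalPhysics.QuantumFieldTheory.Balaban1983to89.B7Prop3GeneralLinearSplitRec
import Literature.MathematicalPhysics.QuantumFieldTheory.Balaban1983to89.B7Prop3GeneralAnalyticRec
import Literature.MathematicalPhysics.QuantumFieldTheory.Balaban1983to89.B7Prop3GeneralLinearBound

/-!
# `Balaban1983to89.B7Prop3GeneralLinearBoundRec` — [Balaban1985Averaging] PROPOSITION 3 AT A GENERAL BACKGROUND, THE BOUND (126) p. 36 — FOR THE RECORD's AVERAGING STRUCTURE ([Balaban1987RG1]
# (0.3)–(0.4)): print's three `[operator − 1]` brackets of (124) are `O(ε)·L·|A|` for the record loops exactly as printed, the rotation defect `D₀` is `2ε′·L·|A|` (`ε′` = regularity of the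
# in-block loops `Γ^σ ∪ (−Γ)`), hence **(126) FOR THE GAUGE-CORRECTED LINEAR PART** `Q̂(V₀)A := L(Q(V₀)A)_c − (d_{V̄₀}λ_A)(c)`: `‖Q̂(V₀)A‖ ≤ (1 + 50(d+1)ε + 2ε′)·L·|A|` (LOCATED-N2, road (A′))

statement-level skeleton of published theorems with citation tags; proofs where landed; nothing here is a claim about the Yang–Mills mass gap

CITATION HEADER (lean-in-tree rule).  Cell `pub-ymgap`, seat `pub-ymgap-dag-n05-e` g35 (N05-REC LEAD PEN); item R1 ([3] layer) — file 5 of the Prop. 3 general-background chain for the record.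
`--kind proof --supports stmt-QuantumFields-20541` (K0⁷; count-neutral; no definition).  Sources READ: [3] (124)–(126) p. 36 (`paper:balaban1985-cmp98-averaging`), [Balaban1987RG1] (0.3)–(0.4)
pp. 252–253; engine module `B7Prop3GeneralLinearBound` whose §3 is re-run over the record objects (TOKEN RULE (T1): `Wcx … (boxVec r) ↦ WZ … i`, weights `|IdxZ|⁻¹` with `norm_avgZ_le ∕
sum_IdxZ_const` of `B7Prop3FlatRecSide` for `norm_wsum_le ∕ sum_blockWeight`; the third bracket's contour `Γ_{c₊,x′} ↦ Γ^{σ′}_{c₊,x′}` has the same length bound `dL`); the operator-defect lemmas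
(`norm_conjR_sub_self_le`, `norm_conjR_expUnit_sub_self_le`, `norm_PhiY_sub_self_le`, `norm_Dmlog_mul_right_sub_self_le`) and the path bound `norm_tsum_le` are REUSED BY NAME.
THE HONEST DIFFERENCE (LOCATED-N2, `B7Prop3GeneralLinearSplitRec`): (126) is proved for `Q̂`, NOT for `linQcovZ` itself — the covariant coarse gauge term `(d_{V̄₀}λ_A)(c)` is carried, not
estimated in `sup|A|` (it is not small in that norm); the extra rotation defect `D₀` costs `2ε′·L·|A|` with `ε′` the regularity of the closed in-block loops `(−Γ_{c₋,x}) ∪ Γ^σ_{c₋,x}` (a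
hypothesis here; from the plaquette deviation in the sequel).
WHAT IS PROVED (sorry-free): §1 `WZ_mem`, `norm_XZ_le`; §2 `norm_tsum_stairWord_le` (`≤ dL·a`), `norm_AloopZ_le` (`≤ 2(d+1)L·a`: the (0.4) loop has `2‖offZ r‖₁ + 2L` bonds); §3 ★`norm_bracket1Z_le` (`40(d+1)εLa`),
★`norm_bracket2Z_le` (`10εLa`), ★`norm_bracket3Z_le` (`10dεLa`), ★`norm_D0Z_le` (`2ε′La`), ★★`norm_linQcovZ_gaugeCorrected_sub_main_le` (`‖Q̂ − L·(Q₀A)_c‖ ≤ (50(d+1)ε + 2ε′)·L·a`),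
★★`norm_linQcovZ_gaugeCorrected_le` ((126) for `Q̂`: `≤ (1 + 50(d+1)ε + 2ε′)·L·a`).
HONEST SCOPE.  Print's elementary bound for OUR typed record objects, for the gauge-corrected linear part; `HThm4Rec` UNDISCHARGED; N05 ∕ N07 NOT discharged; counts unmoved (typed 28∕28 ·
discharged 7∕28); one finite 𝕋⁴ programme at fixed ε — nothing continuum ∕ ℝ⁴ ∕ OS ∕ mass gap ∕ Clay.  No `def`, no `instance`, no `notation`, no `sorry`.
-/

set_option autoImplicit false

noncomputable section

open scoped BigOperators
open NormedSpace Finset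

namespace Literature.MathematicalPhysics.QuantumFieldTheory.Balaban1983to89.B7Prop3GeneralLinearBoundRec

open B7Prop1Explicit hiding Site
open B7Prop1Explicit renaming Site → SiteZ
open MatrixLog B7AvgGaugeCovariance B7Prop3GeneralRotated
open B7Prop3Flat (expCfg)
open B7Prop3GeneralLinearBound (norm_conjR_sub_self_le norm_conjR_expUnit_sub_self_le norm_PhiY_sub_self_le norm_Dmlog_mul_right_sub_self_le
  norm_tsum_seg_le)
open B7Eq92Concrete (tHol)
open B7Eq78Linearization (conjR conjR_apply conjR_sub conjR_one)
open B12AverageCorridor267 (Dmlog PhiY PhiY_apply)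
open BlockAveragingZd (offZ IdxZ WZ WZ_def XZ bavgZ bavgZ_apply length_loopWord length_stairWord)
open B7SectCDGaugeAveragesRec (FcovZ wframeZ tildZ dbavgCovZ)
open B7SectEFLinearisationRec (FhatCovZ Q0covZ QcovZ linQcovZ CcovZ AloopZ DXavgZ QprimeCovZ)
open B7Prop3FlatRecSide (l1_offZ_le_dL norm_avgZ_le sum_IdxZ_const sum_IdxZ_fst)
open B7Prop3GeneralLinearRec (norm_Q0covZ_le)
open B7Prop3GeneralAnalyticRec (norm_XZ_le_of_WZ)
open B7Prop3GeneralLinearSplitRec (linQcovZ_split_gauge)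
open T4Continuum (loopWord stairWord)

variable {d : ℕ}

variable {𝔸 : Type*} [NormedRing 𝔸] [NormedAlgebra ℂ 𝔸] [NormOneClass 𝔸] [CompleteSpace 𝔸]
variable (L : ℕ)

/-! ## §1 The record loops of a `U1` background are in `U1`; `‖X₀‖ ≤ 2ε` -/

section Defects

omit [NormedAlgebra ℂ 𝔸] [CompleteSpace 𝔸] in
/-- the (0.4) loops of a `U1` background are in `U1`. [cite: Balaban1987RG1, (0.4) p.253] -/
theorem WZ_mem {V₀ : SiteZ d → Fin d → 𝔸ˣ} (hV₀ : ∀ x κ, V₀ x κ ∈ U1 𝔸) (q : SiteZ d) (κ : Fin d) (i : IdxZ d L) :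
    WZ L V₀ q κ i ∈ U1 𝔸 := by
  rw [WZ_def]; exact hol_mem hV₀ _ _

omit [NormOneClass 𝔸] in
/-- `‖X₀‖ ≤ 2ε`: the exponent `XZ(V₀)` of (0.4) is a convex combination of logarithms of norm `≤ 2‖W_i − 1‖ ≤ 2ε`. [cite: Balaban1985Averaging, p.36, (26) p.21; Balaban1987RG1, (0.4) p.253] -/
theorem norm_XZ_le (hL : 1 ≤ L) (V₀ : SiteZ d → Fin d → 𝔸ˣ) (q : SiteZ d) (κ : Fin d) {ε : ℝ} (hε : ε ≤ 1 / 8)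
    (hW : ∀ i : IdxZ d L, ‖((WZ L V₀ q κ i : 𝔸ˣ) : 𝔸) - 1‖ ≤ ε) :
    ‖XZ L V₀ q κ‖ ≤ 2 * ε :=
  norm_XZ_le_of_WZ hL V₀ q κ hW (hε.trans (by norm_num))

end Defects

/-! ## §2 The path sums of the record: lengths of the staircases and of the (0.4) loop -/

section Paths

variable {V₀ : SiteZ d → Fin d → 𝔸ˣ} (hV₀ : ∀ x κ, V₀ x κ ∈ U1 𝔸) {A : SiteZ d → Fin d → 𝔸} {a : ℝ} (ha : 0 ≤ a)
  (hA : ∀ x κ, ‖A x κ‖ ≤ a)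

omit [NormedAlgebra ℂ 𝔸] [CompleteSpace 𝔸] in
include hV₀ ha hA in
/-- `‖(R_{0,y}A)(Γ^σ_{y,x})‖ ≤ dL·|A|` (a shortest staircase in a centred block has `‖offZ r‖₁ ≤ dL` bonds). [cite: Balaban1985Averaging, (126) p.36; Balaban1987RG1, (0.3) p.252] -/
theorem norm_tsum_stairWord_le (y : SiteZ d) (σ : Equiv.Perm (Fin d)) (r : Fin d → Fin L) :
    ‖tsum V₀ A y (stairWord σ (offZ L r))‖ ≤ d * L * a := by
  refine (norm_tsum_le hV₀ hA y _).trans ?_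
  rw [length_stairWord]
  exact mul_le_mul_of_nonneg_right (by exact_mod_cast l1_offZ_le_dL L r) ha

omit [NormedAlgebra ℂ 𝔸] [CompleteSpace 𝔸] in
include hV₀ ha hA in
/-- `‖A_i^{(1)}‖ ≤ 2(d+1)L·|A|` (the (0.4) loop `Γ^σ ∪ [x,x′] ∪ (−Γ^{σ′}) ∪ (−c)` has `2‖x − c₋‖₁ + 2L ≤ 2(d+1)L` bonds). [cite: Balaban1985Averaging, (115) p.34, (126) p.36; Balaban1987RG1, (0.4) p.253] -/
theorem norm_AloopZ_le (q : SiteZ d) (κ : Fin d) (i : IdxZ d L) :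
    ‖AloopZ L V₀ A q κ i‖ ≤ 2 * (d + 1) * L * a := by
  refine (norm_tsum_le hV₀ hA q _).trans ?_
  rw [length_loopWord]
  have h1 : (l1 (offZ L i.1) : ℝ) ≤ d * L := by exact_mod_cast l1_offZ_le_dL L i.1
  push_cast
  nlinarith

end Paths

/-! ## §3 (126) for the record: the three brackets are `O(ε)·L·|A|`, the rotation defect `D₀` is `2ε′·L·|A|`, hence (126) for the gauge-corrected linear part -/

section Bound

variable {V₀ : SiteZ d → Fin d → 𝔸ˣ} (hV₀ : ∀ x κ, V₀ x κ ∈ U1 𝔸) {A : SiteZ d → Fin d → 𝔸} {a : ℝ} (ha : 0 ≤ a)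
  (hA : ∀ x κ, ‖A x κ‖ ≤ a) (hL : 1 ≤ L) (q : SiteZ d) (κ : Fin d) {ε : ℝ} (hε0 : 0 ≤ ε) (hε : ε ≤ 1 / 8)
  (hW : ∀ i : IdxZ d L, ‖((WZ L V₀ q κ i : 𝔸ˣ) : 𝔸) - 1‖ ≤ ε)

include hV₀ ha hA hL hε0 hε hW in
/-- FIRST BRACKET: `‖Φ(Σ_x L^{−d}Ψ_x(A_x^{(1)})) − Σ_x L^{−d}A_x^{(1)}‖ ≤ 40(d+1)·ε·L·|A|` (print's second∕third terms of (124) and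
the `g`-parts of the others: `[g(−i ad_Y)g⁻¹(∓i ad_{Y_x}) − 1]` acting on the loop sums, `|Γ_{c,x}∪(−c)| ≤ 2(d+1)L`).
[cite: Balaban1985Averaging, (124)–(126) p.36] -/
theorem norm_bracket1Z_le :
    ‖PhiY (XZ L V₀ q κ) (DXavgZ L V₀ A q κ)
        - ∑ i : IdxZ d L, ((Fintype.card (IdxZ d L) : ℝ))⁻¹ • AloopZ L V₀ A q κ i‖
      ≤ 40 * (d + 1) * ε * L * a := by
  set ℓ : ℝ := 2 * (d + 1) * L * a with hℓ
  have hℓ0 : 0 ≤ ℓ := by positivity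
  have hX := norm_XZ_le L hL V₀ q κ hε hW
  have hAl := norm_AloopZ_le L hV₀ ha hA q κ
  set S := ∑ i : IdxZ d L, ((Fintype.card (IdxZ d L) : ℝ))⁻¹ • AloopZ L V₀ A q κ i with hS
  have hin : ‖DXavgZ L V₀ A q κ - S‖ ≤ 6 * ε * ℓ := by
    rw [hS, DXavgZ, ← Finset.sum_sub_distrib]
    simp_rw [← smul_sub]
    refine norm_avgZ_le L hL _ fun i => ?_
    refine (norm_Dmlog_mul_right_sub_self_le (WZ_mem L hV₀ q κ _) hε0 hε (hW i) _).trans ?_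
    exact mul_le_mul_of_nonneg_left (hAl i) (by positivity)
  have hSn : ‖S‖ ≤ ℓ := norm_avgZ_le L hL _ hAl
  have hDX : ‖DXavgZ L V₀ A q κ‖ ≤ 6 * ε * ℓ + ℓ := by
    have h := norm_add_le (DXavgZ L V₀ A q κ - S) S
    rw [sub_add_cancel] at h
    linarith
  have hΦ := norm_PhiY_sub_self_le hX hε (DXavgZ L V₀ A q κ)
  have key : ‖PhiY (XZ L V₀ q κ) (DXavgZ L V₀ A q κ) - S‖ ≤ 8 * ε * (6 * ε * ℓ + ℓ) + 6 * ε * ℓ := by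
    have h := norm_add_le (PhiY (XZ L V₀ q κ) (DXavgZ L V₀ A q κ) - DXavgZ L V₀ A q κ) (DXavgZ L V₀ A q κ - S)
    rw [sub_add_sub_cancel] at h
    have h8 : 8 * ε * ‖DXavgZ L V₀ A q κ‖ ≤ 8 * ε * (6 * ε * ℓ + ℓ) := mul_le_mul_of_nonneg_left hDX (by positivity)
    linarith
  have h8 : 8 * ε ≤ 1 := by linarith
  have h6 : 0 ≤ 6 * ε * ℓ := by positivity
  have hε2 : 8 * ε * (6 * ε * ℓ) ≤ 6 * ε * ℓ := by
    calc 8 * ε * (6 * ε * ℓ) ≤ 1 * (6 * ε * ℓ) := mul_le_mul_of_nonneg_right h8 h6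
      _ = 6 * ε * ℓ := one_mul _
  have e : 8 * ε * (6 * ε * ℓ + ℓ) = 8 * ε * (6 * ε * ℓ) + 8 * ε * ℓ := by ring
  calc ‖PhiY (XZ L V₀ q κ) (DXavgZ L V₀ A q κ) - S‖ ≤ 8 * ε * (6 * ε * ℓ + ℓ) + 6 * ε * ℓ := key
    _ ≤ 20 * ε * ℓ := by rw [e]; linarith
    _ = 40 * (d + 1) * ε * L * a := by rw [hℓ]; ring

include hV₀ hA hL hε0 hε hW in
/-- SECOND BRACKET: `‖[𝒜 − Σ_x L^{−d}R(W_x)]((R_{0,c₋}A)(c))‖ ≤ 10·ε·L·|A|` (print's fifth term `[e^{i ad_Y} − …]L⁻¹(R_{0,c₋}A)(c)`,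
operator part). [cite: Balaban1985Averaging, (124)–(126) p.36] -/
theorem norm_bracket2Z_le :
    ‖conjR (expUnit (XZ L V₀ q κ)) (tsum V₀ A q (seg κ L))
        - ∑ i : IdxZ d L, ((Fintype.card (IdxZ d L) : ℝ))⁻¹ • conjR (WZ L V₀ q κ i) (tsum V₀ A q (seg κ L))‖
      ≤ 10 * ε * L * a := by
  set Rc := tsum V₀ A q (seg κ L) with hRc
  have hR : ‖Rc‖ ≤ L * a := norm_tsum_seg_le L hV₀ hA q κ
  have hX := norm_XZ_le L hL V₀ q κ hε hW
  have h1 : ‖conjR (expUnit (XZ L V₀ q κ)) Rc - Rc‖ ≤ 8 * ε * ‖Rc‖ := norm_conjR_expUnit_sub_self_le hX hε Rc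
  have h2 : ‖∑ i : IdxZ d L, ((Fintype.card (IdxZ d L) : ℝ))⁻¹ • conjR (WZ L V₀ q κ i) Rc - Rc‖ ≤ 2 * ε * ‖Rc‖ := by
    have e : ∑ i : IdxZ d L, ((Fintype.card (IdxZ d L) : ℝ))⁻¹ • conjR (WZ L V₀ q κ i) Rc - Rc
        = ∑ i : IdxZ d L, ((Fintype.card (IdxZ d L) : ℝ))⁻¹ • (conjR (WZ L V₀ q κ i) Rc - Rc) := by
      simp_rw [smul_sub]
      rw [Finset.sum_sub_distrib, sum_IdxZ_const L hL Rc]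
    rw [e]
    exact norm_avgZ_le L hL _ fun i => norm_conjR_sub_self_le (WZ_mem L hV₀ q κ _) (hW i) Rc
  have h := norm_sub_le (conjR (expUnit (XZ L V₀ q κ)) Rc - Rc)
    (∑ i : IdxZ d L, ((Fintype.card (IdxZ d L) : ℝ))⁻¹ • conjR (WZ L V₀ q κ i) Rc - Rc)
  rw [sub_sub_sub_cancel_right] at h
  have h82 : 8 * ε * ‖Rc‖ + 2 * ε * ‖Rc‖ ≤ 10 * ε * (L * a) := by nlinarith
  linarith

include hV₀ ha hA hL hε0 hε hW in
/-- THIRD BRACKET: `‖Σ_{x′} L^{−d}[𝒜 − R(W_x)]R(V₀(c))(R_{0,c₊}A)(Γ_{c₊,x′})‖ ≤ 10·d·ε·L·|A|` (print's fourth term of (124),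
`[… e^{−i ad_Y} − 1]R̄_{0,c}(R_{0,c₊}A)(Γ_{c₊,x′})`). [cite: Balaban1985Averaging, (124)–(126) p.36] -/
theorem norm_bracket3Z_le :
    ‖∑ i : IdxZ d L, ((Fintype.card (IdxZ d L) : ℝ))⁻¹ •
        (conjR (expUnit (XZ L V₀ q κ))
            (conjR (hol V₀ q (seg κ L)) (tsum V₀ A (q + (L : ℤ) • e κ) (stairWord i.2.2 (offZ L i.1))))
          - conjR (WZ L V₀ q κ i)
            (conjR (hol V₀ q (seg κ L)) (tsum V₀ A (q + (L : ℤ) • e κ) (stairWord i.2.2 (offZ L i.1)))))‖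
      ≤ 10 * d * ε * L * a := by
  have hX := norm_XZ_le L hL V₀ q κ hε hW
  refine norm_avgZ_le L hL _ fun i => ?_
  set Y := conjR (hol V₀ q (seg κ L)) (tsum V₀ A (q + (L : ℤ) • e κ) (stairWord i.2.2 (offZ L i.1))) with hY
  have hYn : ‖Y‖ ≤ d * L * a :=
    (norm_conjR_le (hol_mem hV₀ _ _) _).trans (norm_tsum_stairWord_le L hV₀ ha hA _ i.2.2 i.1)
  have h1 := norm_conjR_expUnit_sub_self_le hX hε Y
  have h2 := norm_conjR_sub_self_le (WZ_mem L hV₀ q κ i) (hW i) Y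
  have h := norm_sub_le (conjR (expUnit (XZ L V₀ q κ)) Y - Y) (conjR (WZ L V₀ q κ i) Y - Y)
  rw [sub_sub_sub_cancel_right] at h
  have h82 : 8 * ε * ‖Y‖ + 2 * ε * ‖Y‖ ≤ 10 * d * ε * L * a := by nlinarith
  linarith

omit [CompleteSpace 𝔸] in
include hV₀ hA hL in
/-- **THE ROTATION DEFECT `D₀` IS SMALL**: if every closed in-block loop `(−Γ_{c₋,x}) ∪ Γ^σ_{c₋,x}` (tree staircase back, σ-staircase out, based at `x`) of the background is within `ε′` of `1`,
then `‖D₀‖ = ‖Σ_i w[R(V₀(Γ^σ_{c₋,x})) − R(V₀(Γ_{c₋,x}))](R_{0,x}A)([x,x′])‖ ≤ 2ε′·L·|A|` (`R(V₀(Γ^σ)) = R(V₀(Γ))∘R(g)`, `g = V₀((−Γ) ∪ Γ^σ)`, `‖R(g)Z − Z‖ ≤ 2ε′‖Z‖`). The engine has no such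
term (`Γ^σ = Γ`). [cite: Balaban1985Averaging, (124)–(126) p.36; Balaban1987RG1, (0.3)–(0.4) pp.252–253] -/
theorem norm_D0Z_le {ε' : ℝ}
    (hloop : ∀ (r : Fin d → Fin L) (σ : Equiv.Perm (Fin d)),
      ‖((hol V₀ (q + offZ L r) (revWord (treeWord (offZ L r)) ++ stairWord σ (offZ L r)) : 𝔸ˣ) : 𝔸) - 1‖ ≤ ε') :
    ‖∑ i : IdxZ d L, ((Fintype.card (IdxZ d L) : ℝ))⁻¹ •
          conjR (hol V₀ q (stairWord i.2.1 (offZ L i.1))) (tsum V₀ A (q + offZ L i.1) (seg κ L))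
        - (L : ℝ) • Q0covZ L V₀ A q κ‖ ≤ 2 * ε' * L * a := by
  have hQ : (L : ℝ) • Q0covZ L V₀ A q κ
      = ∑ i : IdxZ d L, ((Fintype.card (IdxZ d L) : ℝ))⁻¹ •
          conjR (hol V₀ q (treeWord (offZ L i.1))) (tsum V₀ A (q + offZ L i.1) (seg κ L)) := by
    have hL0 : (L : ℝ) ≠ 0 := by exact_mod_cast (by omega : L ≠ 0)
    have e : (L : ℝ) * ((L : ℝ) ^ (d + 1))⁻¹ = ((L : ℝ) ^ d)⁻¹ := by
      rw [pow_succ, mul_inv, ← mul_assoc, mul_comm (L : ℝ) (((L : ℝ) ^ d)⁻¹), mul_assoc, mul_inv_cancel₀ hL0, mul_one]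
    rw [Q0covZ, Finset.smul_sum,
      sum_IdxZ_fst L hL (fun r => conjR (hol V₀ q (treeWord (offZ L r))) (tsum V₀ A (q + offZ L r) (seg κ L)))]
    refine Finset.sum_congr rfl fun r _ => ?_
    rw [smul_smul, e]
  rw [hQ, ← Finset.sum_sub_distrib]
  simp_rw [← smul_sub]
  refine norm_avgZ_le L hL _ fun i => ?_
  -- `R(V₀(Γ^σ)) = R(V₀(Γ))∘R(g)`, `g = V₀(Γ)⁻¹V₀(Γ^σ) = V₀((−Γ) ∪ Γ^σ)` based at `x`
  have hg : hol V₀ q (stairWord i.2.1 (offZ L i.1))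
      = hol V₀ q (treeWord (offZ L i.1))
        * hol V₀ (q + offZ L i.1) (revWord (treeWord (offZ L i.1)) ++ stairWord i.2.1 (offZ L i.1)) := by
    rw [hol_append, disp_revWord, disp_treeWord, add_neg_cancel_right,
      hol_revWord' V₀ (x := q) _ _ (by rw [disp_treeWord]), ← mul_assoc, mul_inv_cancel, one_mul]
  set Y := tsum V₀ A (q + offZ L i.1) (seg κ L) with hY
  have hYn : ‖Y‖ ≤ L * a := by
    have h := norm_tsum_le hV₀ hA (q + offZ L i.1) (seg κ L)
    rwa [length_seg, Int.natAbs_natCast] at h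
  rw [hg, conjR_mul_left, ← conjR_sub]
  refine (norm_conjR_le (hol_mem hV₀ _ _) _).trans ?_
  refine (norm_conjR_sub_self_le (hol_mem hV₀ _ _) (hloop i.1 i.2.1) Y).trans ?_
  have hε' : 0 ≤ ε' := le_trans (norm_nonneg _) (hloop i.1 i.2.1)
  nlinarith

include hV₀ ha hA hL hε0 hε hW in
/-- **(126) FOR THE GAUGE-CORRECTED LINEAR PART, MAIN-TERM FORM**: `‖L(Q(V₀)A)_c − (d_{V̄₀}λ_A)(c) − L·(Q₀A)_c‖ ≤ (50(d+1)ε + 2ε′)·L·a` — "The remaining terms are small because the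
functions g(−z), g⁻¹(z), e^{iz} are equal to 1 for z = 0" plus the record's rotation defect; the coarse gauge term `(d_{V̄₀}λ_A)(c) = λ_A(c₋) − R̄_{0,c}λ_A(c₊)` of LOCATED-N2 is subtracted, not
estimated. [cite: Balaban1985Averaging, (124)–(126) p.36; Balaban1987RG1, (0.4) p.253] -/
theorem norm_linQcovZ_gaugeCorrected_sub_main_le {ε' : ℝ}
    (hloop : ∀ (r : Fin d → Fin L) (σ : Equiv.Perm (Fin d)),
      ‖((hol V₀ (q + offZ L r) (revWord (treeWord (offZ L r)) ++ stairWord σ (offZ L r)) : 𝔸ˣ) : 𝔸) - 1‖ ≤ ε') :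
    ‖linQcovZ L V₀ A q κ
        - ((∑ i : IdxZ d L, ((Fintype.card (IdxZ d L) : ℝ))⁻¹ • tsum V₀ A q (stairWord i.2.1 (offZ L i.1))
              - FhatCovZ L V₀ A q)
            - conjR (bavgZ L V₀ q κ)
                (∑ i : IdxZ d L, ((Fintype.card (IdxZ d L) : ℝ))⁻¹ •
                    tsum V₀ A (q + (L : ℤ) • e κ) (stairWord i.2.1 (offZ L i.1))
                  - FhatCovZ L V₀ A (q + (L : ℤ) • e κ)))
        - (L : ℝ) • Q0covZ L V₀ A q κ‖ ≤ (50 * (d + 1) * ε + 2 * ε') * L * a := by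
  have hW1 : ∀ i : IdxZ d L, ‖((WZ L V₀ q κ i : 𝔸ˣ) : 𝔸) - 1‖ < 1 := fun i => (hW i).trans_lt (by linarith)
  have h1 := norm_bracket1Z_le L hV₀ ha hA hL q κ hε0 hε hW
  have h2 := norm_bracket2Z_le L hV₀ hA hL q κ hε0 hε hW
  have h3 := norm_bracket3Z_le L hV₀ ha hA hL q κ hε0 hε hW
  have h0 := norm_D0Z_le L hV₀ hA hL q κ hloop
  rw [linQcovZ_split_gauge L hL V₀ A q κ hW1]
  -- regroup: `(main + B1 + B2 + B3 + D0 + G) − G − main = B1 + (B2 + B3) + D0`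
  rw [show ∀ (M B1 B2 B3 D0 G : 𝔸), M + B1 + B2 + B3 + D0 + G - G - M = B1 + (B2 + B3) + D0 from fun _ _ _ _ _ _ => by abel]
  refine (norm_add_le _ _).trans ?_
  refine (add_le_add ((norm_add_le _ _).trans (add_le_add h1 ((norm_add_le _ _).trans (add_le_add h2 h3)))) h0).trans ?_
  have hd : (0 : ℝ) ≤ d := Nat.cast_nonneg d
  nlinarith

include hV₀ ha hA hL hε0 hε hW in
/-- **(126) FOR THE RECORD** — «|(Q(V₀)A)_c| ≤ |A| + O(1)L²α₀|A|» holds for the GAUGE-CORRECTED linear part: `‖L(Q(V₀)A)_c − (d_{V̄₀}λ_A)(c)‖ ≤ (1 + 50(d+1)ε + 2ε′)·L·a`, with `ε` the (0.4)-loop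
regularity and `ε′` the in-block-loop regularity of the background (both `O(L²α₀)` under (109)). It does NOT hold for `L(Q(V₀)A)_c` itself (LOCATED-N2). [cite: Balaban1985Averaging, (126) p.36; Balaban1987RG1, (0.4) p.253] -/
theorem norm_linQcovZ_gaugeCorrected_le {ε' : ℝ}
    (hloop : ∀ (r : Fin d → Fin L) (σ : Equiv.Perm (Fin d)),
      ‖((hol V₀ (q + offZ L r) (revWord (treeWord (offZ L r)) ++ stairWord σ (offZ L r)) : 𝔸ˣ) : 𝔸) - 1‖ ≤ ε') :
    ‖linQcovZ L V₀ A q κ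
        - ((∑ i : IdxZ d L, ((Fintype.card (IdxZ d L) : ℝ))⁻¹ • tsum V₀ A q (stairWord i.2.1 (offZ L i.1))
              - FhatCovZ L V₀ A q)
            - conjR (bavgZ L V₀ q κ)
                (∑ i : IdxZ d L, ((Fintype.card (IdxZ d L) : ℝ))⁻¹ •
                    tsum V₀ A (q + (L : ℤ) • e κ) (stairWord i.2.1 (offZ L i.1))
                  - FhatCovZ L V₀ A (q + (L : ℤ) • e κ)))‖ ≤ (1 + 50 * (d + 1) * ε + 2 * ε') * (L * a) := by
  have hmain : ‖(L : ℝ) • Q0covZ L V₀ A q κ‖ ≤ L * a := by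
    rw [norm_smul, Real.norm_of_nonneg (Nat.cast_nonneg L)]
    exact mul_le_mul_of_nonneg_left (norm_Q0covZ_le L hL hV₀ hA q κ) (Nat.cast_nonneg L)
  have h := norm_linQcovZ_gaugeCorrected_sub_main_le L hV₀ ha hA hL q κ hε0 hε hW hloop
  have h' := norm_add_le (linQcovZ L V₀ A q κ
        - ((∑ i : IdxZ d L, ((Fintype.card (IdxZ d L) : ℝ))⁻¹ • tsum V₀ A q (stairWord i.2.1 (offZ L i.1))
              - FhatCovZ L V₀ A q)
            - conjR (bavgZ L V₀ q κ)
                (∑ i : IdxZ d L, ((Fintype.card (IdxZ d L) : ℝ))⁻¹ •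
                    tsum V₀ A (q + (L : ℤ) • e κ) (stairWord i.2.1 (offZ L i.1))
                  - FhatCovZ L V₀ A (q + (L : ℤ) • e κ)))
        - (L : ℝ) • Q0covZ L V₀ A q κ) ((L : ℝ) • Q0covZ L V₀ A q κ)
  rw [sub_add_cancel] at h'
  nlinarith

end Bound

end Literature.MathematicalPhysics.QuantumFieldTheory.Balaban1983to89.B7Prop3GeneralLinearBoundRec
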